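import Mathlib
import HarnessLib
import Summits.HubbardSuperconductivity.HubbardSuperconductivity.Theorems.KLProgrammeKLRegimeEngineTwoLegStepV17F2Closers
import Summits.HubbardSuperconductivity.HubbardSuperconductivity.Theorems.KLProgrammeKLRegimeEngineV8DefsU7

/-!
# K3 gen 8, ENGINE child `KLRegimeEngineV17F2` (stmt-HubbardSuperconductivity-20437), stub (e): rows B1/B3 in ENGINE-SIZE currency — the
# (E3d)/(E3e) FITS discharged by the all-scales door `klE3U₀all` of p1b's `…EngineV8DefsU7` §4 (p532183; token #10's threshold `klEngU₀8 ≤ klE3U₀all`)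

Cell gate-hubbard-kl, seat hubbard-kl-r2d-p1 (g5).  The residual rows of stub (e) (HOME/hubbard-kl-r2d-p1/RESIDUAL-TABLE-e-V17F.md) were typed as FITS:
B1 `|z_n(k) − 1| ≤ R.cz·|U|`, B3 `m₁' + 4/3·Gfr₁U² ≤ cz|U|·cDtmin(−1.2)(−0.05)/2`.  Under the registered coupling door (`U ≤ klEngU₀8 P R c ≤ klE3U₀all R`, plan g17
(R41)(iii)) they follow from pure SIZE statements of the one-shot tower — `|z_n(k) − 1| ≤ Z·U²`, `‖∇ I_L[Re Σ_n − K_n∘p]‖ ≤ S·U²` on the shell tube — as soon as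
`Z ≤ 2^10·e¹⁸·κ₀⁴·klE3Acum R` and `S ≤ 2^11·e¹⁸·κ₀⁴·klE3Acum R` (`κ₀² = 2(7+1606732)`, `klE3Acum R = 2^40·klE3A1 R` = p1b's declared all-scales allowance):

* §1 `allScales_numerals_of_le_klE3U₀all` — the two fits at the coefficient `klE3Acum R` under `0 < U ≤ klE3U₀all R` (verbatim the proof of p1b's
  `bareFrame_numerals_of_le_klE3U₀` with `klE3A1 ↦ klE3Acum`); `fieldStrength_fit_of_size` / `slope_fit_of_size` — the row-B1/B3 conversions for any `Z, S` below;
* §2 **`stub_twoLeg_step_of_engineSizes_thr`** — stub (e)'s literal binders (threshold DOORS `c₃ ≤ klEngC₃3 P R`, `U₀c ≤ klEngU₀4 P R c`, `U₀c ≤ klE3U₀all R` —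
  pass `klEngC₃6_le_klEngC₃3`, `klEngU₀8_le_klEngU₀4`, `klEngU₀8_le_klE3U₀all` for token #10 = `klEngU₀8`, or the `klEngU₀9` twins) + B1′ `hzZ`, B2′ `hmS` (sizes),
  `hZ`, `hS` (coefficients within the allowance) + C1 `hcut`, C2 `hsp` ⇒ `TwoLegStepV17F2 L M klEngGeo7 P (klEngQ6 P R) R β U μ n`.

So after this file stub (e)'s open content is: A1 = stub (C); the two SIZES `Z, S ≤ 2^{10|11}e¹⁸κ₀⁴·klE3Acum R` of the scale-`n` one-shot tower at `K_n`
(p1b/(b)-lane); C1/C2 (two-volume legs).  Proofs only; no definitions; nothing about the model is asserted; nothing asserts superconductivity.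
[cite: BenfattoGiulianiMastropietro2006] (§2.4 (2.36), §2.6 (2.98)).
-/

noncomputable section

namespace Summit.HubbardSuperconductivity.HubbardSuperconductivity.Theorems.EngineV8

set_option linter.dupNamespace false -- summit = problem name (single-conjunct summit), D-0017

open Real Finset Literature.MathematicalPhysics.QuantumLattice Literature.Probability.LatticeModels
open Literature.MathematicalPhysics.QuantumLattice.FermiRG Literature.MathematicalPhysics.QuantumLattice.BandSectorCounting
open Summit.HubbardSuperconductivity.HubbardSuperconductivity.Theorems.KLProgrammeLegKernels
open Summit.HubbardSuperconductivity.HubbardSuperconductivity.Theorems.DispersionFlow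
open Summit.HubbardSuperconductivity.HubbardSuperconductivity.Theorems.PerturbedFermiCurve
open Summit.HubbardSuperconductivity.HubbardSuperconductivity.Theorems.KLRegimeSplit
open Summit.HubbardSuperconductivity.HubbardSuperconductivity.Theorems.TwoPointAssembly

/-! ## §1 The (E3d)/(E3e) fits at the all-scales allowance under the all-scales door -/

/-- **The two fits at the coefficient `klE3Acum R` under `0 < U ≤ klE3U₀all R`** (`0 < R.cz`):
`2^10·e¹⁸κ₀⁴·klE3Acum R·U² ≤ cz·|U|` and `2^11·e¹⁸κ₀⁴·klE3Acum R·U² + 4/3·Gfr₁·U² ≤ cz·|U|·cDtmin(−1.2)(−0.05)/2`. -/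
theorem allScales_numerals_of_le_klE3U₀all {R : RenConsts} (hcz : 0 < R.cz) {U : ℝ} (hU : 0 < U) (hUall : U ≤ klE3U₀all R) :
    (2 : ℝ) ^ 10 * Real.exp 1 ^ 18 * Real.sqrt (2 * (7 + 1606732)) ^ 4 * klE3Acum R * U ^ 2 ≤ R.cz * |U| ∧
    (2 : ℝ) ^ 11 * Real.exp 1 ^ 18 * Real.sqrt (2 * (7 + 1606732)) ^ 4 * klE3Acum R * U ^ 2 + 4 / 3 * R.Gfr 1 * U ^ 2 ≤
      R.cz * |U| * (cDtmin (-1.2) (-0.05) / 2) := by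
  have hA := klE3Acum_pos R
  have hκ : (0 : ℝ) < Real.sqrt (2 * (7 + 1606732)) := Real.sqrt_pos.2 (by norm_num)
  have hD0 : 0 < (2 : ℝ) ^ 11 * Real.exp 1 ^ 18 * Real.sqrt (2 * (7 + 1606732)) ^ 4 * klE3Acum R + 4 / 3 * |R.Gfr 1| + 1 := by positivity
  have habs : |U| = U := abs_of_pos hU
  have h2 : U ≤ R.cz * (23 / 200) / ((2 : ℝ) ^ 11 * Real.exp 1 ^ 18 * Real.sqrt (2 * (7 + 1606732)) ^ 4 * klE3Acum R + 4 / 3 * |R.Gfr 1| + 1) :=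
    hUall.trans (min_le_right _ _)
  have h2' : U * ((2 : ℝ) ^ 11 * Real.exp 1 ^ 18 * Real.sqrt (2 * (7 + 1606732)) ^ 4 * klE3Acum R + 4 / 3 * |R.Gfr 1| + 1) ≤ R.cz * (23 / 200) :=
    (le_div_iff₀ hD0).1 h2
  have hcD := cDtmin_wide_ge
  rw [habs]
  refine ⟨?_, ?_⟩
  · have hle : (2 : ℝ) ^ 11 * Real.exp 1 ^ 18 * Real.sqrt (2 * (7 + 1606732)) ^ 4 * klE3Acum R ≤
        (2 : ℝ) ^ 11 * Real.exp 1 ^ 18 * Real.sqrt (2 * (7 + 1606732)) ^ 4 * klE3Acum R + 4 / 3 * |R.Gfr 1| + 1 := by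
      have := abs_nonneg (R.Gfr 1); linarith
    have hUD : U * ((2 : ℝ) ^ 11 * Real.exp 1 ^ 18 * Real.sqrt (2 * (7 + 1606732)) ^ 4 * klE3Acum R) ≤ R.cz * (23 / 200) :=
      (mul_le_mul_of_nonneg_left hle hU.le).trans h2'
    calc (2 : ℝ) ^ 10 * Real.exp 1 ^ 18 * Real.sqrt (2 * (7 + 1606732)) ^ 4 * klE3Acum R * U ^ 2
        = (U * ((2 : ℝ) ^ 11 * Real.exp 1 ^ 18 * Real.sqrt (2 * (7 + 1606732)) ^ 4 * klE3Acum R)) * U / 2 := by ring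
      _ ≤ R.cz * (23 / 200) * U / 2 := by gcongr
      _ ≤ R.cz * U := by nlinarith [mul_pos hcz hU]
  · have hle : (2 : ℝ) ^ 11 * Real.exp 1 ^ 18 * Real.sqrt (2 * (7 + 1606732)) ^ 4 * klE3Acum R + 4 / 3 * R.Gfr 1 ≤
        (2 : ℝ) ^ 11 * Real.exp 1 ^ 18 * Real.sqrt (2 * (7 + 1606732)) ^ 4 * klE3Acum R + 4 / 3 * |R.Gfr 1| + 1 := by
      have := le_abs_self (R.Gfr 1); linarith
    have hUD : U * ((2 : ℝ) ^ 11 * Real.exp 1 ^ 18 * Real.sqrt (2 * (7 + 1606732)) ^ 4 * klE3Acum R + 4 / 3 * R.Gfr 1) ≤ R.cz * (23 / 200) :=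
      (mul_le_mul_of_nonneg_left hle hU.le).trans h2'
    have hc2 : (23 : ℝ) / 200 ≤ cDtmin (-1.2) (-0.05) / 2 := by linarith
    calc (2 : ℝ) ^ 11 * Real.exp 1 ^ 18 * Real.sqrt (2 * (7 + 1606732)) ^ 4 * klE3Acum R * U ^ 2 + 4 / 3 * R.Gfr 1 * U ^ 2
        = U * ((2 : ℝ) ^ 11 * Real.exp 1 ^ 18 * Real.sqrt (2 * (7 + 1606732)) ^ 4 * klE3Acum R + 4 / 3 * R.Gfr 1) * U := by ring
      _ ≤ R.cz * (23 / 200) * U := mul_le_mul_of_nonneg_right hUD hU.le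
      _ ≤ R.cz * (cDtmin (-1.2) (-0.05) / 2) * U := by
          exact mul_le_mul_of_nonneg_right (mul_le_mul_of_nonneg_left hc2 hcz.le) hU.le
      _ = R.cz * U * (cDtmin (-1.2) (-0.05) / 2) := by ring

/-- **Row B1 from a SIZE**: `|z − 1| ≤ Z·U²` with `Z ≤ 2^10·e¹⁸κ₀⁴·klE3Acum R` gives `|z − 1| ≤ cz·|U|` under the all-scales door. -/
theorem fieldStrength_fit_of_size {R : RenConsts} (hcz : 0 < R.cz) {U : ℝ} (hU : 0 < U) (hUall : U ≤ klE3U₀all R) {Z x : ℝ}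
    (hZ : Z ≤ (2 : ℝ) ^ 10 * Real.exp 1 ^ 18 * Real.sqrt (2 * (7 + 1606732)) ^ 4 * klE3Acum R) (hx : |x - 1| ≤ Z * U ^ 2) :
    |x - 1| ≤ R.cz * |U| :=
  hx.trans ((mul_le_mul_of_nonneg_right hZ (sq_nonneg U)).trans (allScales_numerals_of_le_klE3U₀all hcz hU hUall).1)

/-- **Row B3 from a SIZE**: a tube gradient bound `m₁' = S·U²` with `S ≤ 2^11·e¹⁸κ₀⁴·klE3Acum R` satisfies p1b's fit
`m₁' + 4/3·Gfr₁·U² ≤ cz·|U|·cDtmin(−1.2)(−0.05)/2` under the all-scales door. -/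
theorem slope_fit_of_size {R : RenConsts} (hcz : 0 < R.cz) {U : ℝ} (hU : 0 < U) (hUall : U ≤ klE3U₀all R) {S : ℝ}
    (hS : S ≤ (2 : ℝ) ^ 11 * Real.exp 1 ^ 18 * Real.sqrt (2 * (7 + 1606732)) ^ 4 * klE3Acum R) :
    S * U ^ 2 + 4 / 3 * R.Gfr 1 * U ^ 2 ≤ R.cz * |U| * (cDtmin (-1.2) (-0.05) / 2) := by
  have h := (allScales_numerals_of_le_klE3U₀all hcz hU hUall).2
  have hSU : S * U ^ 2 ≤ (2 : ℝ) ^ 11 * Real.exp 1 ^ 18 * Real.sqrt (2 * (7 + 1606732)) ^ 4 * klE3Acum R * U ^ 2 :=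
    mul_le_mul_of_nonneg_right hS (sq_nonneg U)
  exact le_trans (add_le_add hSU le_rfl) h

/-! ## §2 Stub (e) modulo SIZES: B1/B3 fits discharged by the all-scales door -/

/-- **STUB (e) `stub_twoLeg_step` OF 20437 MODULO ENGINE SIZES.**  The stub's literal binders with the thresholds as DOORS (`c ≤ c₃ ≤ klEngC₃3 P R`,
`U ≤ U₀c ≤ klEngU₀4 P R c`, `U₀c ≤ klE3U₀all R` — e.g. `U₀c := klEngU₀8 P R c`), then: B1′ `hzZ` (`|z_n(k) − 1| ≤ Z·U²` on the scale-`n` shell at `K_n`), B2′ `hmS`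
(the shell-tube gradient of the `K_n`-separated reading `≤ S·U²`), the coefficient lines `hZ`, `hS` (within `2^{10}`/`2^{11}·e¹⁸κ₀⁴·klE3Acum R`), and C1 `hcut`, C2 `hsp`.
Conclusion = the stub's. -/
theorem stub_twoLeg_step_of_engineSizes_thr {c₃ U₀c : ℝ} (P : SplitConsts) (R : RenConsts) (c : ℝ) (hc₃ : c₃ ≤ klEngC₃3 P R)
    (hU₀ : U₀c ≤ klEngU₀4 P R c) (hU₀all : U₀c ≤ klE3U₀all R) (hP : P.WF) (hR : R.WF2) (hc : 0 < c) (hc3 : c ≤ c₃)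
    (μ : ℝ) (hμ : μ ∈ klWindowC) (U : ℝ) (hU : 0 < U) (hUle : U ≤ U₀c) (β : ℝ) (hβ : klBetaMin ≤ β) (hβc : β ≤ Real.exp (c / U ^ 2))
    (L M : ℕ) [NeZero L] [NeZero M] (hL : klEngL₃ β U ≤ L) (hM : klEngM₃ β U L ≤ M)
    (n : ℕ) (hn1 : 1 ≤ n) (hn : n ≤ nScales β + 1) (hreg : IsKLRegime U c (-(n : ℤ)))
    (hhist : HistP klPredsV17F2 L M klEngGeo7 P (klEngQ6 P R) R β U μ 0 n)
    (hfr : FrameOK R U (nScales β) μ (klFlowFrameU L M β U μ n))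
    (hE : EngineBoundsAtV17F2 L M klEngGeo7 P (klEngQ6 P R) β U μ n)
    (hJ : TwoLegReadJetBound L M klC4aJetC (klC4aJetC' P R) β U μ (klFlowFrameU L M β U μ n) n)
    -- rows B1′/B2′: the two SIZES of the scale-`n` one-shot tower at `K_n`, and their coefficient lines
    {Z S : ℝ} (hZ : Z ≤ (2 : ℝ) ^ 10 * Real.exp 1 ^ 18 * Real.sqrt (2 * (7 + 1606732)) ^ 4 * klE3Acum R)
    (hS : S ≤ (2 : ℝ) ^ 11 * Real.exp 1 ^ 18 * Real.sqrt (2 * (7 + 1606732)) ^ 4 * klE3Acum R)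
    (hzZ : ∀ k ∈ klShell L μ (klFlowFrameU L M β U μ n) n, |klFieldStrength L M β U μ (klFlowFrameU L M β U μ n) n k - 1| ≤ Z * U ^ 2)
    (hmS : ∀ q : Momentum, |frameLevel μ (klFlowFrameU L M β U μ n) q| ≤ klScale klE0 n →
      ‖fderiv ℝ (evalM (symInterp L (fun p => klLocSelfEnergyRe L M β U μ (klFlowFrameU L M β U μ n) n p -
        (klFlowFrameU L M β U μ n).eval (latticeMomentum L p)))) q‖ ≤ S * U ^ 2)
    -- rows C1–C2
    (hcut : ∀ (Mq : ℕ → ℕ) (L₁ M₁ M₂ : ℕ) [NeZero L₁] [NeZero M₁] [NeZero M₂], L ≤ L₁ → (klEngQ6 P R).M0 β L₁ ≤ M₁ → Mq L₁ ≤ M₁ → M₁ ≤ M₂ →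
      (∀ j < n, histV17F2 L₁ M₁ klEngGeo7 P (klEngQ6 P R) R β U μ j ∧ TwoLegSlopes L₁ M₁ R β U μ (klFlowFrameU L₁ M₁ β U μ j) j) →
      (∀ j < n, histV17F2 L₁ M₂ klEngGeo7 P (klEngQ6 P R) R β U μ j ∧ TwoLegSlopes L₁ M₂ R β U μ (klFlowFrameU L₁ M₂ β U μ j) j) →
        ∀ θ : ℝ, |klLocalPart L₁ M₁ β U μ (klFlowFrameU L₁ M₁ β U μ n) n θ -
          klLocalPart L₁ M₂ β U μ (klFlowFrameU L₁ M₂ β U μ n) n θ| ≤ (klEngQ6 P R).CL β n / 4 / L₁)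
    (hsp : ∀ (Mq : ℕ → ℕ) (L₁ L₂ M₂ : ℕ) [NeZero L₁] [NeZero L₂] [NeZero M₂], L ≤ L₁ → L₁ ∣ L₂ → (klEngQ6 P R).M0 β L₁ ≤ M₂ → Mq L₁ ≤ M₂ →
      (klEngQ6 P R).M0 β L₂ ≤ M₂ → Mq L₂ ≤ M₂ →
      (∀ j < n, histV17F2 L₁ M₂ klEngGeo7 P (klEngQ6 P R) R β U μ j ∧ TwoLegSlopes L₁ M₂ R β U μ (klFlowFrameU L₁ M₂ β U μ j) j) →
      (∀ j < n, histV17F2 L₂ M₂ klEngGeo7 P (klEngQ6 P R) R β U μ j ∧ TwoLegSlopes L₂ M₂ R β U μ (klFlowFrameU L₂ M₂ β U μ j) j) →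
        ∀ θ : ℝ, |klLocalPart L₁ M₂ β U μ (klFlowFrameU L₁ M₂ β U μ n) n θ -
          klLocalPart L₂ M₂ β U μ (klFlowFrameU L₂ M₂ β U μ n) n θ| ≤ (klEngQ6 P R).CL β n / 4 / L₁) :
    TwoLegStepV17F2 L M klEngGeo7 P (klEngQ6 P R) R β U μ n := by
  have _ := hP; have _ := hM; have _ := hn1; have _ := hreg; have _ := hhist; have _ := hE
  have hUall : U ≤ klE3U₀all R := hUle.trans hU₀all
  have hz : ∀ k ∈ klShell L μ (klFlowFrameU L M β U μ n) n, |klFieldStrength L M β U μ (klFlowFrameU L M β U μ n) n k - 1| ≤ R.cz * |U| :=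
    fun k hk => fieldStrength_fit_of_size hR.2.2 hU hUall hZ (hzZ k hk)
  exact twoLegStepV17F2_of_jets_sepTubeGradient_nestedLegs_pkg klEngGeo7 (klEngQ6 P R) P hR hc (hc3.trans hc₃) hμ hU (hUle.trans hU₀) hβ hβc hL hn
    hfr (klEngQ6_CL_nonneg P R β n) klC4aJetC_le_klEngGeo7_S (klC4aJetC'_le_klEngQ6_S' P R) hJ.1 hJ.2 hz hmS
    (slope_fit_of_size hR.2.2 hU hUall hS) hcut hsp

end Summit.HubbardSuperconductivity.HubbardSuperconductivity.Theorems.EngineV8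

end
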